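import Summits.Ventures.Crystal3D.StickySpheres.FccLoomisWhitney
import Summits.Ventures.Crystal3D.StickySpheres.SquareDiscCount
import HarnessLib

/-!
# Cube-facet no-gain in the fcc lattice: `(100)` slab samples cost `4π ρ² − O(ρ)`

HONEST FRAMING. Part of the venture `Summits/Ventures/Crystal3D` (cell `crystal3d-full`). An
ON-LATTICE rung of the cell's K1 atom in the cube-facet direction `(100)`; nothing off-lattice.

The cell's `LatticeNoGain` (HOME/cf-p1/lean/WulffSelection.lean, ROUTE.md §12.4): for every unit
normal `ν` a packing drawn from the fcc lattice `Λ₀ = fccStacking 1 √(2/3)` that contains the rigid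
slab sample normal to `ν` of lateral radius `ρ` has deficiency `≥ 2 φ(ν) π ρ² − C ρ`,
`φ(ν) = (√2/4) Σ_{12 bonds} |⟪w, ν⟫|`.  `BarlowAxisNoGain.lean` is the basal case `ν = e₃ = (111)`,
`φ = √3`.  This file is the CUBE-FACET case: in the model frame of `fccStacking 1 √(2/3)` (in-layer
spacing `1`, `(111)` layers horizontal) the cube normal is `ν₁₀₀ = (√2/2, √6/6, −√3/3)`
(`⟪barlowPos k i j, ν₁₀₀⟫ = (i + j)/√2`: the `(100)` planes are `i + j = const`, spacing `1/√2`,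
each a unit SQUARE lattice in the coordinates `(i, k)`), and `φ(ν₁₀₀) = 2`.

* `four_mul_card_cubeLayer_add_numContacts_le` — the `(100)` LAYER BOUND, exact: for a unit packing
  on the fcc lattice and any `s`, `4 · #{balls with i + j = s} + C(x) ≤ 6N`.  Proof by the two
  charts of `FccLoomisWhitney.lean`: `2C + #∂ψ₁ + #∂ψ₂ ≤ 12N` (every contact is a unit step of one
  chart; slot count), each `#∂ψ ≥ 2 Σ_d |π_d ψX|`
  (tree, `two_mul_sum_card_dropCoord_le_card_boundaryPairs`), and four of the six coordinate
  directions of the charts are transverse to the `(100)` layers, so the corresponding projections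
  are injective on a layer: `#∂ψ₁ + #∂ψ₂ ≥ 8 E_s`.
* `fcc_cubeFacet_noGain` — with `R = 2`, `C = 16π`: if `x ⊆ Λ₀` contains every site `p` with
  `−2R ≤ ⟪p, ν₁₀₀⟫ ≤ −R` and `‖p‖² − ⟪p, ν₁₀₀⟫² ≤ ρ²` (`ρ ≥ R`), then
  `4 π ρ² − C ρ ≤ 6N − numContacts x` (`= 2 φ(100) π ρ²` to leading order): the layer `i + j = −4`
  (height `−2√2 ∈ [−4, −2]`) contains the square-lattice disc count `≥ π(ρ − 2)²`
  (`SquareDiscCount.lean`).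

WHAT THIS IS NOT: not `LatticeNoGain` for general `ν` (needs the shadow counts of tilted discs), not
`NoReconstructionGain` (off-lattice, OPEN); rung F-C1 not moved.
-/

noncomputable section

namespace Summit.Ventures.Crystal3D

open Finset
open scoped RealInnerProductSpace
open Literature.Probability.LatticeModels (Site unitStep boundaryPairs dropCoord
  two_mul_sum_card_dropCoord_le_card_boundaryPairs)
open Literature.MathematicalPhysics.StatisticalMechanics (barlowPos barlowStacking fccStacking
  constHagg isHaggSeq_const haggLabel_const barlowPos_mem barlowPos_apply_zero barlowPos_apply_one
  barlowPos_apply_two twelve_mul_dist_barlowPos_sq dist_barlowPos_eq_iff_form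
  le_dist_barlowPos_of_ideal)

/-- **The `(100)` layer bound.** For a unit packing `x` on the fcc lattice with coordinates
`x i = barlowPos 1 √(2/3) constHagg (kf i) (pf i) (qf i)` and any `s : ℤ`:
`4 · #{i | pf i + qf i = s} + numContacts x ≤ 6N`. -/
theorem four_mul_card_cubeLayer_add_numContacts_le {N : ℕ}
    (x : Fin N → EuclideanSpace ℝ (Fin 3)) (hx : IsUnitPacking x) (kf pf qf : Fin N → ℤ)
    (hc : ∀ i, x i = barlowPos 1 (Real.sqrt (2 / 3)) constHagg (kf i) (pf i) (qf i)) (s : ℤ) :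
    4 * (univ.filter fun i => pf i + qf i = s).card + numContacts x ≤ 6 * N := by
  classical
  have hh : (Real.sqrt (2 / 3)) ^ 2 = 2 / 3 * (1 : ℝ) ^ 2 := by
    rw [Real.sq_sqrt (by norm_num)]; ring
  set a₁ : Fin N → Site 3 := fun i => ![pf i, qf i + kf i, -kf i] with ha₁
  set a₂ : Fin N → Site 3 := fun i => ![kf i + pf i + qf i, pf i + qf i, -qf i] with ha₂
  set E := univ.filter fun i => pf i + qf i = s with hE
  have hinjx := hx.injective
  have hcoord_inj : ∀ i j, kf i = kf j → pf i = pf j → qf i = qf j → i = j := by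
    intro i j h1 h2 h3
    apply hinjx; rw [hc i, hc j, h1, h2, h3]
  have ha₁inj : Function.Injective a₁ := by
    intro i j h
    have h0 := congrFun h 0; have h1 := congrFun h 1; have h2 := congrFun h 2
    simp only [ha₁, Matrix.cons_val_zero, Matrix.cons_val_one, Matrix.cons_val] at h0 h1 h2
    exact hcoord_inj i j (by omega) h0 (by omega)
  have ha₂inj : Function.Injective a₂ := by
    intro i j h
    have h0 := congrFun h 0; have h1 := congrFun h 1; have h2 := congrFun h 2
    simp only [ha₂, Matrix.cons_val_zero, Matrix.cons_val_one, Matrix.cons_val] at h0 h1 h2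
    exact hcoord_inj i j (by omega) (by omega) (by omega)
  -- every contact is a unit step in one of the two charts (as in `FccLoomisWhitney.lean`)
  have hstep : ∀ i j, dist (x i) (x j) = 1 →
      (∃ d : Fin 3, ∃ b : Bool, a₁ j = a₁ i + unitStep d b) ∨
        (∃ d : Fin 3, ∃ b : Bool, a₂ j = a₂ i + unitStep d b) := by
    intro i j hd
    rw [dist_comm, hc j, hc i, dist_barlowPos_eq_iff_form one_pos hh constHagg,
      haggLabel_const, haggLabel_const] at hd
    rcases step_of_fccForm_eq_twelve _ _ _ hd with ⟨d, b, h⟩ | ⟨d, b, h⟩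
    · refine Or.inl ⟨d, b, ?_⟩
      ext l; rw [Pi.add_apply, ← congrFun h l]
      fin_cases l <;> simp [ha₁] <;> ring
    · refine Or.inr ⟨d, b, ?_⟩
      ext l; rw [Pi.add_apply, ← congrFun h l]
      fin_cases l <;> simp [ha₂] <;> ring
  have hdeg : ∀ i, coordination x i ≤
      (univ.filter fun j => ∃ d : Fin 3, ∃ b : Bool, a₁ j = a₁ i + unitStep d b).card +
        (univ.filter fun j => ∃ d : Fin 3, ∃ b : Bool, a₂ j = a₂ i + unitStep d b).card := by
    intro i
    refine (card_le_card fun j hj => ?_).trans (card_union_le _ _)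
    rw [mem_contactNeighbors] at hj
    rw [mem_union, mem_filter, mem_filter]
    rcases hstep i j hj.2 with h | h
    · exact Or.inl ⟨mem_univ _, h⟩
    · exact Or.inr ⟨mem_univ _, h⟩
  have hslot₁ := sum_card_stepNeighbors_add_card_boundaryPairs a₁ ha₁inj
  have hslot₂ := sum_card_stepNeighbors_add_card_boundaryPairs a₂ ha₂inj
  have hhand := sum_coordination_eq x
  have hsumdeg : ∑ i, coordination x i ≤
      ∑ i, (univ.filter fun j => ∃ d : Fin 3, ∃ b : Bool, a₁ j = a₁ i + unitStep d b).card +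
        ∑ i, (univ.filter fun j => ∃ d : Fin 3, ∃ b : Bool, a₂ j = a₂ i + unitStep d b).card := by
    rw [← sum_add_distrib]; exact sum_le_sum fun i _ => hdeg i
  have hid : 2 * numContacts x + (boundaryPairs (univ.image a₁)).card +
      (boundaryPairs (univ.image a₂)).card ≤ 12 * N := by omega
  -- a projection transverse to the layers is injective on a layer
  have hproj : ∀ (a : Fin N → Site 3) (d : Fin 3),
      (∀ i ∈ E, ∀ j ∈ E, Fin.removeNth d (a i) = Fin.removeNth d (a j) → i = j) →
        E.card ≤ (dropCoord d (univ.image a)).card := by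
    intro a d hinj
    have hsub : E.image (fun i => Fin.removeNth d (a i)) ⊆ dropCoord d (univ.image a) := by
      intro w hw
      obtain ⟨i, -, rfl⟩ := mem_image.1 hw
      rw [dropCoord]
      exact mem_image_of_mem _ (mem_image_of_mem _ (mem_univ i))
    calc E.card = (E.image fun i => Fin.removeNth d (a i)).card :=
          (card_image_of_injOn fun i hi j hj h => hinj i (mem_coe.1 hi) j (mem_coe.1 hj) h).symm
      _ ≤ _ := card_le_card hsub
  have hEs : ∀ i ∈ E, pf i + qf i = s := fun i hi => (mem_filter.1 hi).2
  -- chart 1, all three directions; chart 2, direction 1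
  have h10 : E.card ≤ (dropCoord 0 (univ.image a₁)).card := hproj a₁ 0 fun i hi j hj h => by
    have h0 := congrFun h 0; have h1 := congrFun h 1
    simp [Fin.removeNth_apply, ha₁] at h0 h1
    exact hcoord_inj i j (by omega) (by have := hEs i hi; have := hEs j hj; omega) (by omega)
  have h11 : E.card ≤ (dropCoord 1 (univ.image a₁)).card := hproj a₁ 1 fun i hi j hj h => by
    have h0 := congrFun h 0; have h1 := congrFun h 1
    simp [Fin.removeNth_apply, ha₁, Fin.succAbove] at h0 h1
    have := hEs i hi; have := hEs j hj
    exact hcoord_inj i j (by omega) h0 (by omega)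
  have h12 : E.card ≤ (dropCoord 2 (univ.image a₁)).card := hproj a₁ 2 fun i hi j hj h => by
    have h0 := congrFun h 0; have h1 := congrFun h 1
    simp [Fin.removeNth_apply, ha₁, Fin.succAbove] at h0 h1
    have := hEs i hi; have := hEs j hj
    exact hcoord_inj i j (by omega) h0 (by omega)
  have h21 : E.card ≤ (dropCoord 1 (univ.image a₂)).card := hproj a₂ 1 fun i hi j hj h => by
    have h0 := congrFun h 0; have h1 := congrFun h 1
    simp [Fin.removeNth_apply, ha₂, Fin.succAbove] at h0 h1
    have := hEs i hi; have := hEs j hj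
    exact hcoord_inj i j (by omega) (by omega) (by omega)
  have hLW₁ := two_mul_sum_card_dropCoord_le_card_boundaryPairs (univ.image a₁)
  have hLW₂ := two_mul_sum_card_dropCoord_le_card_boundaryPairs (univ.image a₂)
  rw [Fin.sum_univ_three] at hLW₁ hLW₂
  omega

/-- `barlowPos … 0 0 0 = 0`: the model stacking contains the origin. -/
theorem barlowPos_zero_zero_zero :
    barlowPos 1 (Real.sqrt (2 / 3)) constHagg 0 0 0 = 0 := by
  ext l
  fin_cases l <;> simp [barlowPos_apply_zero, barlowPos_apply_one, barlowPos_apply_two]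

/-- Squared norm of an fcc site in coordinates: `‖(k,i,j)‖² = i² + j² + k² + ij + ik + jk`. -/
theorem norm_sq_barlowPos_fcc (k i j : ℤ) :
    ‖barlowPos 1 (Real.sqrt (2 / 3)) constHagg k i j‖ ^ 2 =
      ((i ^ 2 + j ^ 2 + k ^ 2 + i * j + i * k + j * k : ℤ) : ℝ) := by
  have hh : (Real.sqrt (2 / 3)) ^ 2 = 2 / 3 * (1 : ℝ) ^ 2 := by
    rw [Real.sq_sqrt (by norm_num)]; ring
  have h := twelve_mul_dist_barlowPos_sq hh constHagg k i j 0 0 0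
  rw [barlowPos_zero_zero_zero, dist_zero_right, haggLabel_const, haggLabel_const] at h
  push_cast at h ⊢
  nlinarith [h]

/-- Heights along the cube normal: `⟪barlowPos k i j, ν₁₀₀⟫ = (i + j)·(√2/2)` for
`ν₁₀₀ = (√2/2, √6/6, −√3/3)` (so the `(100)` planes of the model fcc lattice are `i + j = const`). -/
theorem inner_barlowPos_cubeNormal (k i j : ℤ) :
    ⟪barlowPos 1 (Real.sqrt (2 / 3)) constHagg k i j,
      !₂[Real.sqrt 2 / 2, Real.sqrt 6 / 6, -(Real.sqrt 3 / 3)]⟫ = ((i : ℝ) + j) * (Real.sqrt 2 / 2) := by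
  have h3 : Real.sqrt 3 ^ 2 = 3 := Real.sq_sqrt (by norm_num)
  have h3pos : 0 < Real.sqrt 3 := Real.sqrt_pos.2 (by norm_num)
  have h6 : Real.sqrt 6 = Real.sqrt 2 * Real.sqrt 3 := by
    rw [← Real.sqrt_mul (by norm_num)]; norm_num
  rw [EuclideanSpace.inner_eq_star_dotProduct]
  simp [dotProduct, Fin.sum_univ_three, barlowPos_apply_zero, barlowPos_apply_one,
    barlowPos_apply_two]
  rw [h6]
  have e1 : Real.sqrt 3 / 3 * ((k : ℝ) * (Real.sqrt 2 / Real.sqrt 3)) = (k : ℝ) * Real.sqrt 2 / 3 := by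
    field_simp
  have e2 : Real.sqrt 2 * Real.sqrt 3 / 6 * (Real.sqrt 3 / 2 * ((j : ℝ) + (k : ℝ) / 3)) =
      Real.sqrt 2 / 4 * ((j : ℝ) + (k : ℝ) / 3) := by
    have : Real.sqrt 2 * Real.sqrt 3 / 6 * (Real.sqrt 3 / 2 * ((j : ℝ) + (k : ℝ) / 3)) =
        Real.sqrt 2 * (Real.sqrt 3 ^ 2) / 12 * ((j : ℝ) + (k : ℝ) / 3) := by ring
    rw [this, h3]; ring
  rw [e1, e2]; ring

/-- **Cube-facet no-gain in the fcc lattice (`(100)` instance of `LatticeNoGain`).** With `R = 2`,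
`C = 16π` and `ν₁₀₀ = (√2/2, √6/6, −√3/3)`: a unit packing `x ⊆ fccStacking 1 √(2/3)` that
contains every lattice site `p` with `−2R ≤ ⟪p, ν₁₀₀⟫ ≤ −R` and `‖p‖² − ⟪p, ν₁₀₀⟫² ≤ ρ²`
(`ρ ≥ R`) satisfies `4 π ρ² − C ρ ≤ 6N − numContacts x`. -/
theorem fcc_cubeFacet_noGain :
    ∃ R C : ℝ, 0 < R ∧
      ∀ ρ : ℝ, R ≤ ρ → ∀ (N : ℕ) (x : Fin N → EuclideanSpace ℝ (Fin 3)), IsUnitPacking x →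
        (∀ i, x i ∈ fccStacking 1 (Real.sqrt (2 / 3))) →
        (∀ p ∈ fccStacking 1 (Real.sqrt (2 / 3)),
            -(2 * R) ≤ ⟪p, !₂[Real.sqrt 2 / 2, Real.sqrt 6 / 6, -(Real.sqrt 3 / 3)]⟫ →
            ⟪p, !₂[Real.sqrt 2 / 2, Real.sqrt 6 / 6, -(Real.sqrt 3 / 3)]⟫ ≤ -R →
            ‖p‖ ^ 2 - ⟪p, !₂[Real.sqrt 2 / 2, Real.sqrt 6 / 6, -(Real.sqrt 3 / 3)]⟫ ^ 2 ≤ ρ ^ 2 →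
              ∃ i, x i = p) →
          4 * Real.pi * ρ ^ 2 - C * ρ ≤ 6 * (N : ℝ) - (numContacts x : ℝ) := by
  classical
  refine ⟨2, 16 * Real.pi, by norm_num, ?_⟩
  intro ρ hρ N x hx hmem hsample
  have h2 : Real.sqrt 2 ^ 2 = 2 := Real.sq_sqrt (by norm_num)
  have h2bnd : 1 ≤ Real.sqrt 2 ∧ Real.sqrt 2 ≤ 2 := by
    constructor <;> nlinarith [h2, Real.sqrt_nonneg 2]
  have hh : (Real.sqrt (2 / 3)) ^ 2 = 2 / 3 * (1 : ℝ) ^ 2 := by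
    rw [Real.sq_sqrt (by norm_num)]; ring
  -- coordinates
  have hcoord : ∀ i, ∃ k a b : ℤ, x i = barlowPos 1 (Real.sqrt (2 / 3)) constHagg k a b :=
    fun i => hmem i
  choose kf pf qf hc using hcoord
  have hfcc_inj : ∀ {k₁ a₁ b₁ k₂ a₂ b₂ : ℤ},
      barlowPos 1 (Real.sqrt (2 / 3)) constHagg k₁ a₁ b₁ =
        barlowPos 1 (Real.sqrt (2 / 3)) constHagg k₂ a₂ b₂ → (k₁, a₁, b₁) = (k₂, a₂, b₂) := by
    intro k₁ a₁ b₁ k₂ a₂ b₂ heq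
    by_contra hne
    have h1 := le_dist_barlowPos_of_ideal isHaggSeq_const one_pos hh hne
    rw [heq, dist_self] at h1
    exact absurd h1 (by norm_num)
  -- the layer bound at `s = -4`
  set E := univ.filter fun i => pf i + qf i = -4 with hE
  have hlayer := four_mul_card_cubeLayer_add_numContacts_le x hx kf pf qf hc (-4)
  -- the sites `(i, j = -4 - i, k)` with `(i + 2)² + (k - 2)² ≤ ρ²` are balls of `x`
  set T : Finset (ℤ × ℤ) := E.image fun i' => (pf i', kf i') with hT
  have hTE : T.card ≤ E.card := card_image_le
  have hdisc := square_disc_count (-2) 2 ρ hρ T ?_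
  swap
  · intro i k hcond
    set p := barlowPos 1 (Real.sqrt (2 / 3)) constHagg k i (-4 - i) with hp
    have hinner : ⟪p, !₂[Real.sqrt 2 / 2, Real.sqrt 6 / 6, -(Real.sqrt 3 / 3)]⟫ =
        -4 * (Real.sqrt 2 / 2) := by
      rw [hp, inner_barlowPos_cubeNormal]; push_cast; ring
    have hnorm : ‖p‖ ^ 2 = ((i ^ 2 + (-4 - i) ^ 2 + k ^ 2 + i * (-4 - i) + i * k + (-4 - i) * k
        : ℤ) : ℝ) := by rw [hp, norm_sq_barlowPos_fcc]
    obtain ⟨i', hi'⟩ := hsample p (barlowPos_mem _ _ _) (by rw [hinner]; nlinarith)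
      (by rw [hinner]; nlinarith) (by
        rw [hnorm, hinner]; push_cast
        nlinarith [hcond, h2])
    have hi'E : i' ∈ E := by
      rw [hE, mem_filter]
      have := hfcc_inj ((hc i').symm.trans hi')
      simp only [Prod.mk.injEq] at this
      exact ⟨mem_univ _, by omega⟩
    have hcoords : (pf i', kf i') = (i, k) := by
      have := hfcc_inj ((hc i').symm.trans hi')
      simp only [Prod.mk.injEq] at this ⊢
      exact ⟨this.2.1, this.1⟩
    rw [hT, mem_image]
    exact ⟨i', hi'E, hcoords⟩
  -- assemble
  have hE' : 4 * (E.card : ℝ) + (numContacts x : ℝ) ≤ 6 * (N : ℝ) := by exact_mod_cast hlayer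
  have hTE' : (T.card : ℝ) ≤ (E.card : ℝ) := by exact_mod_cast hTE
  nlinarith [hdisc, Real.pi_pos]

end Summit.Ventures.Crystal3D

end
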